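/-
Origin: expansion seat `planner-pub-hodgecm-toy-0`, handover #2 2026-08-18T04:13:45Z (`HOME/pub-hodgecm-toy/lean/Toy/GaloisClosure.lean`, md5 1034a2e3, 194 lines);
landed by the gen-5 packager in gate run 21 as `HodgeCM/Model/Toy/GaloisClosure.lean` (import ^import Toy\.→import HodgeCM.Model.Toy. ×1).
-/
-- HANDOVER (planner-pub-hodgecm-toy-0, unit pub-hodgecm-toy): WIP module `Toy.GaloisClosure`; intended final module
-- `HodgeCM.Model.Toy.GaloisClosure` (kind L5, toy model / consistency witness); rename `import Toy.X` ↦ the final prefix.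
/-
Copyright (c) 2026. Released under Apache 2.0 license as described in the file LICENSE.
-/
import Mathlib
import Summits.HodgeConjecture.HodgeCM.Model.Toy.Isogeny

/-!
# A Galois CM field of degree `≥ 6` over any CM field (discharging `GaloisCMOracle`)

For a CM field `K` we construct, inside `ℂ`, the field
`N K := ℚ(all conjugates of a primitive element of K, all primitive 7th roots of unity)`,
i.e. the compositum of the Galois closure of `K` (w.r.t. any embedding) with `ℚ(ζ₇)`, and prove:

* `N K` is a finite Galois extension of `ℚ` (it is the splitting field in `ℂ` of
  `minpoly θ · Φ₇`);
* `N K` is totally complex (it contains a copy of `K`);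
* complex conjugation restricts to an automorphism `c` of `N K` with `IsConj φ c` for EVERY
  embedding `φ : N K →+* ℂ` — because `N K` is generated by elements `z` that are either images
  `ψ θ` of the CM field `K` (where `conj ∘ φ ∘ ψ = φ ∘ ψ ∘ c_K` for all embeddings, `K` being CM:
  `NumberField.IsCMField.isConj_complexConj`) or roots of unity (where conjugation is inversion);
  hence `N K` is a CM field (`NumberField.IsCMField.of_forall_isConj`);
* `6 ≤ [N K : ℚ]` (it contains `ℚ(ζ₇)`), and `K ↪ N K`.

This is the classical fact "the Galois closure of a CM field, and a compositum of CM fields, is CM"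
(Shimura, *Abelian varieties with complex multiplication and modular functions*, 1998, Prop. 18.2;
Milne, *Complex multiplication*, Prop. 1.4), in the amount needed to instantiate
`HodgeCM.Toy.GaloisCMOracle` (`HodgeCM.Toy.galoisCMOracle`), so that the toy model satisfies
`Fact_cmDominated` with no oracle input.
-/

noncomputable section

open Polynomial IntermediateField NumberField NumberField.ComplexEmbedding
open scoped ComplexConjugate

namespace HodgeCM.Toy

namespace GaloisClosure

variable (K : CMField)

/-- A power basis (primitive element) of the CM field `K` over `ℚ`. -/
def pb : PowerBasis ℚ K := Field.powerBasisOfFiniteOfSeparable ℚ K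

/-- The polynomial `minpoly_ℚ(θ) · Φ₇`. -/
def pol : ℚ[X] := minpoly ℚ (pb K).gen * cyclotomic 7 ℚ

/-- (Ported verbatim from the HodgeCMPerL package; no docstring in the source.) -/
lemma pol_ne_zero : pol K ≠ 0 :=
  mul_ne_zero (minpoly.ne_zero (pb K).isIntegral_gen) (cyclotomic_ne_zero 7 ℚ)

/-- The set of complex roots of `pol K`. -/
abbrev S : Set ℂ := (pol K).rootSet ℂ

/-- (Ported verbatim from the HodgeCMPerL package; no docstring in the source.) -/
lemma mem_S_iff {z : ℂ} :
    z ∈ S K ↔ aeval z (minpoly ℚ (pb K).gen) = 0 ∨ aeval z (cyclotomic 7 ℚ) = 0 := by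
  rw [mem_rootSet_of_ne (pol_ne_zero K), pol, map_mul, mul_eq_zero]

/-- The field `N K = ℚ(S K) ⊂ ℂ`: Galois closure of `K` composed with `ℚ(ζ₇)`. -/
abbrev N : IntermediateField ℚ ℂ := IntermediateField.adjoin ℚ (S K)

/-- (Ported verbatim from the HodgeCMPerL package; no docstring in the source.) -/
instance isSplittingField : (pol K).IsSplittingField ℚ (N K) :=
  adjoin_rootSet_isSplittingField (IsAlgClosed.splits _)

/-- (Ported verbatim from the HodgeCMPerL package; no docstring in the source.) -/
instance normal : Normal ℚ (N K) := Normal.of_isSplittingField (pol K)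

/-- (Ported verbatim from the HodgeCMPerL package; no docstring in the source.) -/
instance finiteDimensional : FiniteDimensional ℚ (N K) :=
  IsSplittingField.finiteDimensional (N K) (pol K)

/-- (Ported verbatim from the HodgeCMPerL package; no docstring in the source.) -/
instance numberField : NumberField (N K) := NumberField.mk

/-- (Ported verbatim from the HodgeCMPerL package; no docstring in the source.) -/
instance isGalois : IsGalois ℚ (N K) := IsGalois.mk

/-- Every embedding of `K` into `ℂ` lands in `N K`. -/
lemma apply_mem (ψ : K →+* ℂ) (x : K) : ψ x ∈ N K := by
  obtain ⟨q, rfl⟩ := (pb K).exists_eq_aeval' x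
  have hg : ψ (pb K).gen ∈ N K := by
    refine subset_adjoin ℚ (S K) ((mem_S_iff K).mpr (Or.inl ?_))
    have h := minpoly.aeval ℚ (pb K).gen
    have : aeval (ψ.toRatAlgHom (pb K).gen) (minpoly ℚ (pb K).gen) = 0 := by
      rw [aeval_algHom_apply, h, map_zero]
    simpa using this
  have e : ψ (aeval (pb K).gen q) = aeval (ψ (pb K).gen) q := by
    have := (aeval_algHom_apply ψ.toRatAlgHom (pb K).gen q).symm
    simpa using this
  rw [e, show ψ (pb K).gen = ((⟨ψ (pb K).gen, hg⟩ : N K) : ℂ) from rfl, aeval_coe]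
  exact SetLike.coe_mem _

/-- An embedding `ψ : K →+* ℂ` corestricted to `N K`. -/
def toN (ψ : K →+* ℂ) : K →+* N K := ψ.codRestrict (N K) (apply_mem K ψ)

/-- (Ported verbatim from the HodgeCMPerL package; no docstring in the source.) -/
@[simp] lemma coe_toN (ψ : K →+* ℂ) (x : K) : ((toN K ψ x : N K) : ℂ) = ψ x := rfl

/-- Complex conjugation as a `ℚ`-algebra automorphism of `ℂ`. -/
def conjQ : ℂ ≃ₐ[ℚ] ℂ :=
  AlgEquiv.ofRingEquiv (f := (starRingAut : RingAut ℂ)) (fun q => by simp)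

/-- (Ported verbatim from the HodgeCMPerL package; no docstring in the source.) -/
@[simp] lemma conjQ_apply (z : ℂ) : conjQ z = conj z := rfl

/-- Complex conjugation restricted to the normal subfield `N K`. -/
def c : Gal(N K/ℚ) := conjQ.restrictNormal (N K)

/-- (Ported verbatim from the HodgeCMPerL package; no docstring in the source.) -/
@[simp] lemma coe_c (x : N K) : ((c K x : N K) : ℂ) = conj (x : ℂ) :=
  AlgEquiv.restrictNormal_commutes conjQ (N K) x

/-- `N K` is totally complex: it contains the totally complex field `K`. -/
instance isTotallyComplex : IsTotallyComplex (N K) where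
  isComplex := fun w => by
    rw [← InfinitePlace.not_isReal_iff_isComplex, InfinitePlace.isReal_iff]
    intro hw
    have ψ : K →+* ℂ := Classical.arbitrary _
    apply IsTotallyComplex.complexEmbedding_not_isReal (K := K) (w.embedding.comp (toN K ψ))
    rw [ComplexEmbedding.isReal_iff] at hw ⊢
    ext x
    have := RingHom.congr_fun hw (toN K ψ x)
    simpa [conjugate_coe_eq] using this

/-- The key computation on generators: for `z ∈ S K` and any embedding `φ` of `N K`,
`conj (φ z) = φ (conj z)`. -/
lemma conj_apply_gen (φ : N K →+* ℂ) (z : ℂ) (hz : z ∈ S K) :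
    conj (φ ⟨z, subset_adjoin ℚ (S K) hz⟩) = φ (c K ⟨z, subset_adjoin ℚ (S K) hz⟩) := by
  rcases (mem_S_iff K).mp hz with h | h
  · -- `z = ψ θ` for an embedding `ψ` of the CM field `K`
    let ψ : K →ₐ[ℚ] ℂ := (pb K).lift z h
    have hψ : ψ (pb K).gen = z := (pb K).lift_gen z h
    have e1 : (⟨z, subset_adjoin ℚ (S K) hz⟩ : N K) = toN K ψ.toRingHom (pb K).gen :=
      Subtype.ext (by simp [hψ])
    have e2 : c K (toN K ψ.toRingHom (pb K).gen)
        = toN K ψ.toRingHom (IsCMField.complexConj K (pb K).gen) := by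
      apply Subtype.ext
      rw [coe_c, coe_toN, coe_toN]
      exact ((IsCMField.isConj_complexConj K ψ.toRingHom).eq _).symm
    rw [e1, e2]
    have := (IsCMField.isConj_complexConj K (φ.comp (toN K ψ.toRingHom))).eq (pb K).gen
    simpa only [RingHom.comp_apply, Complex.star_def] using this.symm
  · -- `z` is a primitive 7th root of unity: conjugation is inversion
    have h7 : z ^ 7 = 1 := by
      have hr : IsRoot (cyclotomic 7 ℂ) z := by
        rwa [aeval_def, ← eval_map, map_cyclotomic] at h
      exact ((isRoot_cyclotomic_iff).mp hr).pow_eq_one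
    set y : N K := ⟨z, subset_adjoin ℚ (S K) hz⟩ with hy
    have hy7 : y ^ 7 = 1 := Subtype.ext (by simp [y, h7])
    have hφ7 : (φ y) ^ 7 = 1 := by rw [← map_pow, hy7, map_one]
    have hzinv : conj z = z⁻¹ := (Complex.inv_eq_conj (Complex.norm_eq_one_of_pow_eq_one h7 (by norm_num))).symm
    have hcy : c K y = y⁻¹ := Subtype.ext (by rw [coe_c]; simp [y, hzinv])
    rw [hcy, map_inv₀, ← Complex.inv_eq_conj (Complex.norm_eq_one_of_pow_eq_one hφ7 (by norm_num))]

/-- Complex conjugation on `N K` is THE conjugation for every complex embedding. -/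
lemma isConj_c (φ : N K →+* ℂ) : IsConj φ (c K) := by
  have key : (conjugate φ).toRatAlgHom = (φ.comp (c K : N K →+* N K)).toRatAlgHom := by
    apply adjoin_algHom_ext ℚ
    intro z hz
    exact conj_apply_gen K φ z hz
  exact RingHom.ext fun x => DFunLike.congr_fun key x

/-- (Ported verbatim from the HodgeCMPerL package; no docstring in the source.) -/
instance isCMField : IsCMField (N K) := IsCMField.of_forall_isConj (N K) (isConj_c K)

/-- A primitive 7th root of unity in `ℂ`. -/
def ζ : ℂ := Complex.exp (2 * Real.pi * Complex.I / 7)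

/-- (Ported verbatim from the HodgeCMPerL package; no docstring in the source.) -/
lemma ζ_prim : IsPrimitiveRoot ζ 7 := by
  simpa [ζ] using Complex.isPrimitiveRoot_exp 7 (by norm_num)

/-- (Ported verbatim from the HodgeCMPerL package; no docstring in the source.) -/
lemma ζ_mem_S : ζ ∈ S K := by
  refine (mem_S_iff K).mpr (Or.inr ?_)
  rw [aeval_def, ← eval_map, map_cyclotomic]
  exact ζ_prim.isRoot_cyclotomic (by norm_num)

/-- (Ported verbatim from the HodgeCMPerL package; no docstring in the source.) -/
lemma finrank_adjoin_ζ : Module.finrank ℚ ℚ⟮ζ⟯ = 6 := by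
  rw [adjoin.finrank ((ζ_prim.isIntegral (by norm_num)).tower_top), ← cyclotomic_eq_minpoly_rat ζ_prim (by norm_num),
    natDegree_cyclotomic, Nat.totient_prime (by norm_num)]

/-- (Ported verbatim from the HodgeCMPerL package; no docstring in the source.) -/
lemma six_le_finrank : 6 ≤ Module.finrank ℚ (N K) := by
  have hle : ℚ⟮ζ⟯ ≤ N K := adjoin_simple_le_iff.mpr (subset_adjoin ℚ (S K) (ζ_mem_S K))
  rw [← finrank_adjoin_ζ]
  exact LinearMap.finrank_le_finrank_of_injective
    (f := (IntermediateField.inclusion hle).toLinearMap) (inclusion_injective hle)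

/-- The Galois CM field over `K`, bundled. -/
def galoisCM : CMField := ⟨N K⟩

end GaloisClosure

open GaloisClosure in
/-- **The oracle, discharged**: for every CM field `K`, `GaloisClosure.N K ⊂ ℂ` is a Galois CM field of
degree `≥ 6` receiving `K`. -/
def galoisCMOracle : GaloisCMOracle where
  F K := galoisCM K
  gal K := GaloisClosure.isGalois K
  six K := six_le_finrank K
  emb K := toN K (Classical.arbitrary (K →+* ℂ))

end HodgeCM.Toy
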